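import Summits.QuantumFields.YangMills.Theorems.BalabanUVNodesN14StubTwoTextOptShellOfUndressedClassLawTVAndBinderK3V5
import Summits.QuantumFields.YangMills.Theorems.BalabanUVNodesK3V6Defs
import Summits.QuantumFields.YangMills.Theorems.BalabanUVNodesN20CoreEdgeShellDialStubTextK3V6
import Summits.QuantumFields.YangMills.Theorems.BalabanUVNodesN27AtSpineReadingOfRecord13CoPHVCut

/-!
# DAG node N14 (NE1′) — K3⁸ v6 STUB 2's REGISTERED TEXT (`K3V6Defs` names, rev 28∕29, recipe (δⱽ)) AT THE ZERO CUT AND THE ℓ¹-OPTIMAL SHELL SPLIT FROM THE KEYED LIVE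
# LINE, THE KEYED UNDRESSED CLASS-LAW TV OF RECORD AND NODE N14's KEYED BINDER — the (B)-FREE faces of FILE 6's road transfer to EVERY version slot `v` VERBATIM; and K3⁸
# BY NAME modulo stub 1's V text

Cell `pub-ymgap` (HUMAN RULING D-0062, Track A), WIDTH SEAT `pub-ymgap-dag-n14-w2` (NODE n14 = NE1′), generation 6, FILE 9; `--kind proof --supports
stmt-QuantumFields-27366 --as helper` (K3⁸ `SpineGivenEndpointR13SepCoPHV`, dag-lead KEY MAP v2 ∕ GATE v1.69; skeleton v6 b4e55110ab73e679, stub 2 `stub_expansion13HV`; helper, NOT a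
discharge; count-neutral).  THEOREMS ONLY (0 `def`, 0 `instance`, 0 `sorry`).  Imports this seat's FILE 6 `…StubTwoTextOptShellOfUndressedClassLawTVAndBinderK3V5` (p619828; through it
FILE 5, dag-n20-w3's 13∕13b, g2's MGF forms of record), dag-n27-w1's by-name mirror `…K3V6Defs` (the `…V` ∕ `…BFree` faces, `keyedExtractionV_of_bFree`,
`spineGivenEndpointR13SepCoPHV_of_stubTextsV`), dag-n20-w3's 13R `…N20CoreEdgeShellDialStubTextK3V6` (`pinned_relWeight_coreEdgeV_optShell`: the pin, N20 and the N19′ conjunct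
`KeyedCoreEdgeHolderD4V β cr⋆ rr` at the ℓ¹-optimal split — ITS declarer by R455 (A), cell bus ADJACENCY-1 11:10Z; one copy in the tree) and dag-n27-c's `…N27AtSpineReadingOfRecord13CoPHVCut`
(`keyedExtraction_crOfRecord₁₃VAt_cut`, the (B)-free extraction identities of record) — all BY NAME; edits nothing.  (Route import cone via `K3V5Defs`∕`K3V6Defs`, as the g5∕g6 text files.)

WHY.  K3⁸ (stmt-QuantumFields-27366) = K3⁷'s text with the version slot `v : Revision₁₃ F 2 θ h` threaded through the (B)∕END prefixes; stub 2 of v6 asks v5's five faces with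
`KeyedExtraction ↦ KeyedExtractionV`, `KeyedCoreEdgeHolderD4 ↦ KeyedCoreEdgeHolderD4V` (the prefix read at the revised datum), and plan g85 ∕ the mirror record that a road NOT
READING (B) transfers to every slot verbatim via the `…BFree` shapes (`…V_of_bFree`).  FILE 6's road reads neither (B) nor END (this seat's census answer, INBOX l.35534): its N19′
face is dag-n20-w3's `core_crOfRecord₁₃VAt_optShell` under `ForSmallCouplings.of_forall`, its N27x face the live-line extraction identities.  This file types that in the v6 names:
* `keyedExtractionBFree_crOfRecord₁₃V_of_liveLine` — the (B)-free N27x face from the keyed live line + (H-ζ) (dag-n27-c's `keyedExtraction_crOfRecord₁₃VAt_cut`; (H-U) absolute,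
  `0 ≤ ζ` from the provisos).
* ★★★ `stubExpansion13HVText_optShell_of_liveLine_of_keyedUndressedClassLawTV_of_keyedBinder` — K3⁸ v6 STUB 2's TEXT VERBATIM (`KeyedRatesHolderD4V` unread) from the SAME two
  keyed hypotheses as FILE 6 (keyed live line + (H-ζ); keyed UNDRESSED per-set class-law TV of record + node N14's keyed binder on the classes of record + positive undressed
  class totals), witness `(0, sh⋆, crOfRecord₁₃V 0 sh⋆)`: `PinnedAtLive` ∕ `KeyedRelWeight` ∕ `KeyedCoreEdgeHolderD4V` (dag-n20-w3's 13R `pinned_relWeight_coreEdgeV_optShell`) ·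
  `KeyedShellWeight` (13b on FILE 5, as FILE 6) · `KeyedExtractionV` (the (B)-free face above through the mirror's `keyedExtractionV_of_bFree`).
* ★ `spineGivenEndpointR13SepCoPHV_of_stubRatesVText_of_liveLine_of_keyedUndressedClassLawTV_of_keyedBinder` — K3⁸ BY NAME modulo stub 1's v6 text (ONE application of the mirror's
  `spineGivenEndpointR13SepCoPHV_of_stubTextsV`).  NOT a proof of K3⁸: stub 1's text and the two keyed hypotheses are DISPLAYED.

HONEST FRAMING.  By-name bookkeeping on hypothesis SHAPES; the keyed live line ∕ (H-ζ), the undressed class-law TV of record (the letter the caricature says FAILS at the full history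
key — window-key-core ∕ dag-n20-w5 (LS); this is the TEMPLATE at v6's pinned full key, see this seat's A6-NOTE) and N14's binder of record are HYPOTHESES inhabited for no tuple (K0⁷
OPEN) and produced by nobody; NOT a proof of `stub_expansion13HV` nor of K3⁸; proves NO estimate of the programme; nothing of Bałaban's asserted; NE1′ ∕ NE7 ∕ NE7b ∕ NE7c NOT PRINTED
as two-run statements for d = 4, NOT proved; N14 ∕ N19 ∕ N20 ∕ N21 ∕ N27 NOT discharged; K3⁸ OPEN, v6 STANDS, not claimed; counts UNMOVED (typed 28∕28 · discharged 5∕28).  One finite 𝕋⁴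
programme at fixed ε; R4 closes only the CONDITIONAL finite-𝕋⁴ rung `BalabanLadder.UV` — NOT ℝ⁴, NOT OS, NOT the Yang–Mills mass gap (Clay), which is NOT proved by any of this.
-/

set_option autoImplicit false

noncomputable section

open MeasureTheory ProbabilityTheory Finset
open scoped ENNReal BigOperators Matrix.Norms.L2Operator

namespace YMDAG.N14.StubTwoTextVOfUndressedClassLawTVAndBinder

open Literature.MathematicalPhysics.QuantumFieldTheory.Balaban1983to89
open Literature.MathematicalPhysics.QuantumFieldTheory.Balaban1983to89.T4Continuum
open Literature.MathematicalPhysics.QuantumFieldTheory.Balaban1983to89.Node00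
open T4ContinuumYM4Torus (ForSmallCouplings)
open Summit.QuantumFields.BalabanUV.T4Continuum.Spine
open Summit.QuantumFields.BalabanUV.T4Continuum.NE1p.DressedMGFForm (TiltedMeanMatching)
open Summit.QuantumFields.YangMills.Theorems.K3V5Defs (SpineReading RateReadingFn RunSel LetterReading CutReading rrOfRecord GuardedReadingN16
  KeyedRelWeight KeyedShellWeight LiveSel PinnedAtLive)
open Summit.QuantumFields.YangMills.Theorems.K3V6Defs (KeyedRatesHolderD4V KeyedCoreEdgeHolderD4V KeyedExtractionV KeyedExtractionBFree keyedExtractionV_of_bFree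
  spineGivenEndpointR13SepCoPHV_of_stubTextsV)
open Summit.QuantumFields.YangMills.BalabanUVNodes.N20CoreEdgeShellDial (exists_optShellSplit keyedShellWeight_crOfRecord₁₃V_optShell_of_l1Mismatch)
open Summit.QuantumFields.YangMills.BalabanUVNodes.N20CoreEdgeShellDialStubTextK3V6 (pinned_relWeight_coreEdgeV_optShell)
open Summit.QuantumFields.YangMills.BalabanUVNodes.N21KeyedShellWeightShellZero (zeta_nonneg_of_provisos₁₃CoPH)
open Summit.QuantumFields.YangMills.Theorems.BalabanUVNodesN27SpineRecord (keyedExtraction_crOfRecord₁₃VAt_cut)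
open YMDAG.UVSplit hiding SU
open YMDAG.N14.AtSpineReading13CoPH
open YMDAG.N14.L1MismatchOfBinderAndClassLawTV (l1Mismatch_dressed_of_undressed_noBad summable_noBadBudget)

variable (jc : CutReading) (sh : ShellSplit₁₃CoPH 2 0)

/-- **THE (B)-FREE N27x FACE FROM THE KEYED LIVE LINE** — `KeyedExtractionBFree` of the V reading at ANY cut reading and shell split, from the keyed live-selector line + (H-ζ)
(dag-n27-c's `keyedExtraction_crOfRecord₁₃VAt_cut` BY NAME; (H-U) is node00-def-K0c's absolute `localBgMeasurable`, `0 ≤ ζ` by n21-w's `zeta_nonneg_of_provisos₁₃CoPH`).  Through the mirror's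
`keyedExtractionV_of_bFree` it serves EVERY version slot (the partition functions are the record's). [bookkeeping] -/
theorem keyedExtractionBFree_crOfRecord₁₃V_of_liveLine
    (hlive : ∀ (F : T4Family) (θ : Stage13HParams F 2), θ.Provisos₁₃CoPH F 2 → (θ.ZhUnity F 2 ∧ θ.SlotsNondegenerate₁₃ F 2) → θ.Admissible F 2 →
      LiveSel F θ ∧ ZetaMeasurable F 2 θ.ζ) :
    KeyedExtractionBFree fun F θ hP g₀ os => crOfRecord₁₃V (jc F θ hP g₀ os) sh F θ hP g₀ os := by
  intro F θ hP hG hθ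
  obtain ⟨hsel, hζm⟩ := hlive F θ hP hG hθ
  exact keyedExtraction_crOfRecord₁₃VAt_cut (K₀ := 0) (jc := jc) (sh := sh) θ hP (EOfRecord₁₃ F 2 θ.toStage13Params) hsel (localBgMeasurable F 2 θ.ν) hζm
    (zeta_nonneg_of_provisos₁₃CoPH F θ hP)

/-- **★★★ K3⁸ v6 STUB 2's TEXT, VERBATIM, AT `(jc, sh) := (0, sh⋆)` FROM THE KEYED LIVE LINE, THE KEYED UNDRESSED CLASS-LAW TV OF RECORD AND NODE N14's KEYED BINDER** — the SAME two keyed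
hypotheses as FILE 6 (`…K3V5`), now concluding the v6 text: `KeyedRatesHolderD4V` and the N16 guard UNREAD; witness `(0, sh⋆, crOfRecord₁₃V 0 sh⋆)` with `sh⋆` the ℓ¹-optimal shells at the
undressed constants `c_K = log Σ weightB₁₃ K 0 − log Σ weightA₁₃ K 0`; faces: `PinnedAtLive` ∕ `KeyedRelWeight` ∕ `KeyedCoreEdgeHolderD4V` (dag-n20-w3's 13R
`pinned_relWeight_coreEdgeV_optShell`) · `KeyedShellWeight` (13b on FILE 5's `l1Mismatch_dressed_of_undressed_noBad` in g2's MGF form) · `KeyedExtractionV` (the (B)-free face above via the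
mirror).  NOT a proof of `stub_expansion13HV`. [bookkeeping] -/
theorem stubExpansion13HVText_optShell_of_liveLine_of_keyedUndressedClassLawTV_of_keyedBinder
    (hlive : ∀ (F : T4Family) (θ : Stage13HParams F 2), θ.Provisos₁₃CoPH F 2 → (θ.ZhUnity F 2 ∧ θ.SlotsNondegenerate₁₃ F 2) → θ.Admissible F 2 →
      LiveSel F θ ∧ ZetaMeasurable F 2 θ.ζ)
    (hN14 : ∀ (F : T4Family) (θ : Stage13HParams F 2) (hP : θ.Provisos₁₃CoPH F 2), (θ.ZhUnity F 2 ∧ θ.SlotsNondegenerate₁₃ F 2) → θ.Admissible F 2 →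
      ∀ (g₀ : ℕ → ℝ) (os : List (ULoop F)), ∃ η ρ₀ : ℕ → ℝ, (∀ K, 0 ≤ η K) ∧ Summable η ∧ Summable ρ₀ ∧
        (letI : DecidableEq (Σ K, SiteSeqKey F (0 + K)) := Classical.decEq _
         TiltedMeanMatching 1 (classSet₁₃ θ 0 g₀) (fun _ _ => ∅)
          (fun K (U : GaugeField (F.P (0 + K)) 0 (Node00.SU 2)) => T4GenFunBounds.prodObs ((datumOfRecord₁₃CoPH F 2 θ hP).scheme g₀) (0 + K) os U) (classMeasA₁₃ θ 0 g₀)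
          (fun K (U : GaugeField (F.P (0 + K + 1)) 0 (Node00.SU 2)) => T4GenFunBounds.prodObs ((datumOfRecord₁₃CoPH F 2 θ hP).scheme g₀) (0 + K + 1) os U) (classMeasB₁₃ θ 0 g₀)
          η) ∧
        (∀ (K : ℕ), ∀ S ⊆ classSet₁₃ θ 0 g₀ K,
          |(∑ x ∈ S, weightA₁₃ θ hP 0 g₀ os K 0 x) / (∑ x ∈ classSet₁₃ θ 0 g₀ K, weightA₁₃ θ hP 0 g₀ os K 0 x)
            - (∑ x ∈ S, weightB₁₃ θ hP 0 g₀ os K 0 x) / (∑ x ∈ classSet₁₃ θ 0 g₀ K, weightB₁₃ θ hP 0 g₀ os K 0 x)| ≤ ρ₀ K) ∧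
        (∀ K, 0 < ∑ x ∈ classSet₁₃ θ 0 g₀ K, weightA₁₃ θ hP 0 g₀ os K 0 x) ∧
        (∀ K, 0 < ∑ x ∈ classSet₁₃ θ 0 g₀ K, weightB₁₃ θ hP 0 g₀ os K 0 x)) :
    ∀ β : ℝ, 2 / 3 < β → β < 1 →
      ∀ (𝔯 : RateReading₁₃CoPH 2) (ksel : RunSel) (ℓ : LetterReading) (ℓ₃ : T4Family → Node00.NE3Letters₁₁) (g B : T4Family → ℝ),
        GuardedReadingN16 𝔯 ksel ℓ ℓ₃ g B → KeyedRatesHolderD4V β (rrOfRecord 𝔯 ksel) →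
        ∃ (jc : CutReading) (sh : ShellSplit₁₃CoPH 2 0) (cr : SpineReading), PinnedAtLive jc sh cr ∧
          KeyedRelWeight cr ∧ KeyedShellWeight cr ∧ KeyedExtractionV cr ∧ KeyedCoreEdgeHolderD4V β cr (rrOfRecord 𝔯 ksel) := by
  intro β _ _ 𝔯 ksel ℓ ℓ₃ g Bφ _ _
  obtain ⟨sh, hsh⟩ := exists_optShellSplit (N := 2) 0 (fun F θ hP g₀ os K =>
    Real.log (∑ x ∈ classSet₁₃ θ 0 g₀ K, weightB₁₃ θ hP 0 g₀ os K 0 x) - Real.log (∑ x ∈ classSet₁₃ θ 0 g₀ K, weightA₁₃ θ hP 0 g₀ os K 0 x))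
  obtain ⟨hpin, hrel, hcoreV⟩ := pinned_relWeight_coreEdgeV_optShell sh _ hsh β (rrOfRecord 𝔯 ksel)
  refine ⟨fun _ _ _ _ _ _ => 0, sh, fun F θ hP g₀ os => crOfRecord₁₃V (fun _ => 0) sh F θ hP g₀ os, hpin, hrel, ?_, ?_, hcoreV⟩
  · -- `KeyedShellWeight` — exactly as FILE 6
    refine keyedShellWeight_crOfRecord₁₃V_optShell_of_l1Mismatch (fun _ _ _ _ _ _ => 0) sh _ hsh ?_
    intro F θ hP hG hθ g₀ os
    obtain ⟨hsel, hζm⟩ := hlive F θ hP hG hθ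
    obtain ⟨η, ρ₀, hη0, hηs, hρ0s, hTM, hρ0, hZA0, hZB0⟩ := hN14 F θ hP hG hθ g₀ os
    letI : DecidableEq (Σ K, SiteSeqKey F (0 + K)) := Classical.decEq _
    have hA := mgfForm_weightA₁₃ θ 0 hP (EOfRecord₁₃ F 2 θ.toStage13Params) hsel hζm (zeta_nonneg_of_provisos₁₃CoPH F θ hP) g₀ os
    have hB := mgfForm_weightB₁₃ θ 0 hP (EOfRecord₁₃ F 2 θ.toStage13Params) hsel hζm (zeta_nonneg_of_provisos₁₃CoPH F θ hP) g₀ os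
    have hmis := fun K (t : ℝ) (ht : |t| ≤ 1) => l1Mismatch_dressed_of_undressed_noBad hA hB hTM hη0 hρ0 hZA0 hZB0 K ht
    refine ⟨_, fun K => ?_, summable_noBadBudget (B := (1 : ℝ)) zero_le_one hρ0s hηs hη0, fun K t ht => (hmis K t ht).2, fun K t ht => (hmis K t ht).1⟩
    have h := (hmis K 0 (by rw [abs_zero]; exact zero_le_one)).2
    exact (mul_nonneg_iff_of_pos_right (hZA0 K)).mp ((Finset.sum_nonneg fun _ _ => le_max_left _ _).trans h)
  · -- `KeyedExtractionV` — the (B)-free face through the mirror's transfer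
    exact keyedExtractionV_of_bFree (keyedExtractionBFree_crOfRecord₁₃V_of_liveLine (fun _ _ _ _ _ _ => 0) sh hlive)

/-- **★ K3⁸ BY NAME MODULO STUB 1's v6 TEXT** (ONE application of the mirror's `spineGivenEndpointR13SepCoPHV_of_stubTextsV`): stub 1's registered v6 text (`∃ β 𝔯 …, GuardedReadingN16 … ∧
KeyedRatesHolderD4V β (rrOfRecord 𝔯 ksel)`) + the two keyed hypotheses of ★★★ ⇒ the rev-28∕29 crux `SpineGivenEndpointR13SepCoPHV`.  NOT a proof of K3⁸ (stub 1's text and the keyed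
hypotheses are DISPLAYED, inhabited for no tuple). [bookkeeping] -/
theorem spineGivenEndpointR13SepCoPHV_of_stubRatesVText_of_liveLine_of_keyedUndressedClassLawTV_of_keyedBinder
    (h₁ : ∃ β : ℝ, 2 / 3 < β ∧ β < 1 ∧
      ∃ (𝔯 : RateReading₁₃CoPH 2) (ksel : RunSel) (ℓ : LetterReading) (ℓ₃ : T4Family → Node00.NE3Letters₁₁) (g B : T4Family → ℝ),
        GuardedReadingN16 𝔯 ksel ℓ ℓ₃ g B ∧ KeyedRatesHolderD4V β (rrOfRecord 𝔯 ksel))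
    (hlive : ∀ (F : T4Family) (θ : Stage13HParams F 2), θ.Provisos₁₃CoPH F 2 → (θ.ZhUnity F 2 ∧ θ.SlotsNondegenerate₁₃ F 2) → θ.Admissible F 2 →
      LiveSel F θ ∧ ZetaMeasurable F 2 θ.ζ)
    (hN14 : ∀ (F : T4Family) (θ : Stage13HParams F 2) (hP : θ.Provisos₁₃CoPH F 2), (θ.ZhUnity F 2 ∧ θ.SlotsNondegenerate₁₃ F 2) → θ.Admissible F 2 →
      ∀ (g₀ : ℕ → ℝ) (os : List (ULoop F)), ∃ η ρ₀ : ℕ → ℝ, (∀ K, 0 ≤ η K) ∧ Summable η ∧ Summable ρ₀ ∧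
        (letI : DecidableEq (Σ K, SiteSeqKey F (0 + K)) := Classical.decEq _
         TiltedMeanMatching 1 (classSet₁₃ θ 0 g₀) (fun _ _ => ∅)
          (fun K (U : GaugeField (F.P (0 + K)) 0 (Node00.SU 2)) => T4GenFunBounds.prodObs ((datumOfRecord₁₃CoPH F 2 θ hP).scheme g₀) (0 + K) os U) (classMeasA₁₃ θ 0 g₀)
          (fun K (U : GaugeField (F.P (0 + K + 1)) 0 (Node00.SU 2)) => T4GenFunBounds.prodObs ((datumOfRecord₁₃CoPH F 2 θ hP).scheme g₀) (0 + K + 1) os U) (classMeasB₁₃ θ 0 g₀)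
          η) ∧
        (∀ (K : ℕ), ∀ S ⊆ classSet₁₃ θ 0 g₀ K,
          |(∑ x ∈ S, weightA₁₃ θ hP 0 g₀ os K 0 x) / (∑ x ∈ classSet₁₃ θ 0 g₀ K, weightA₁₃ θ hP 0 g₀ os K 0 x)
            - (∑ x ∈ S, weightB₁₃ θ hP 0 g₀ os K 0 x) / (∑ x ∈ classSet₁₃ θ 0 g₀ K, weightB₁₃ θ hP 0 g₀ os K 0 x)| ≤ ρ₀ K) ∧
        (∀ K, 0 < ∑ x ∈ classSet₁₃ θ 0 g₀ K, weightA₁₃ θ hP 0 g₀ os K 0 x) ∧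
        (∀ K, 0 < ∑ x ∈ classSet₁₃ θ 0 g₀ K, weightB₁₃ θ hP 0 g₀ os K 0 x)) :
    Summit.QuantumFields.YangMills.Theses.BalabanUVNodes.SpineGivenEndpointR13SepCoPHV :=
  spineGivenEndpointR13SepCoPHV_of_stubTextsV h₁ (stubExpansion13HVText_optShell_of_liveLine_of_keyedUndressedClassLawTV_of_keyedBinder hlive hN14)


/-! ## §2 (v1.1, APPEND-ONLY) THE SLIM EDITION — the positive undressed class totals of ★★★'s second hypothesis are AUTOMATIC on the keyed live line (E1∕E2: they ARE the
record's dressed partition functions `Z_{0+K}(0)`, `Z_{0+K+1}(0)`, positive by dag-n20's HYPOTHESIS-FREE `schemeZ_pos_datumOfRecord₁₃CoPH`; dag-n20's `sum_classSet₁₃_weightA_pos_of_sel` ∕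
dag-n20-w1's `…_pos_of_liveSel` are the same remark, inlined here to keep the import cone), so K3⁸ v6 STUB 2's TEXT follows from the keyed live line + (H-ζ) and EXACTLY TWO LETTERS per
guarded admissible tuple: the keyed UNDRESSED per-set class-law TV of record and node N14's keyed binder. -/

/-- **★★★ K3⁸ v6 STUB 2's TEXT, VERBATIM, AT `(0, sh⋆)` FROM THE KEYED LIVE LINE AND EXACTLY TWO LETTERS — the keyed UNDRESSED class-law TV of record and node N14's keyed binder** (slim
edition of ★★★ above: the two positivity conjuncts are discharged on the live line by E1∕E2 + `schemeZ_pos_datumOfRecord₁₃CoPH`).  NOT a proof of `stub_expansion13HV` (the two letters are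
inhabited for no tuple — K0⁷ OPEN — and produced by nobody). [bookkeeping] -/
theorem stubExpansion13HVText_optShell_of_liveLine_of_keyedUndressedClassLawTV_of_keyedBinder'
    (hlive : ∀ (F : T4Family) (θ : Stage13HParams F 2), θ.Provisos₁₃CoPH F 2 → (θ.ZhUnity F 2 ∧ θ.SlotsNondegenerate₁₃ F 2) → θ.Admissible F 2 →
      LiveSel F θ ∧ ZetaMeasurable F 2 θ.ζ)
    (hN14 : ∀ (F : T4Family) (θ : Stage13HParams F 2) (hP : θ.Provisos₁₃CoPH F 2), (θ.ZhUnity F 2 ∧ θ.SlotsNondegenerate₁₃ F 2) → θ.Admissible F 2 →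
      ∀ (g₀ : ℕ → ℝ) (os : List (ULoop F)), ∃ η ρ₀ : ℕ → ℝ, (∀ K, 0 ≤ η K) ∧ Summable η ∧ Summable ρ₀ ∧
        (letI : DecidableEq (Σ K, SiteSeqKey F (0 + K)) := Classical.decEq _
         TiltedMeanMatching 1 (classSet₁₃ θ 0 g₀) (fun _ _ => ∅)
          (fun K (U : GaugeField (F.P (0 + K)) 0 (Node00.SU 2)) => T4GenFunBounds.prodObs ((datumOfRecord₁₃CoPH F 2 θ hP).scheme g₀) (0 + K) os U) (classMeasA₁₃ θ 0 g₀)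
          (fun K (U : GaugeField (F.P (0 + K + 1)) 0 (Node00.SU 2)) => T4GenFunBounds.prodObs ((datumOfRecord₁₃CoPH F 2 θ hP).scheme g₀) (0 + K + 1) os U) (classMeasB₁₃ θ 0 g₀)
          η) ∧
        (∀ (K : ℕ), ∀ S ⊆ classSet₁₃ θ 0 g₀ K,
          |(∑ x ∈ S, weightA₁₃ θ hP 0 g₀ os K 0 x) / (∑ x ∈ classSet₁₃ θ 0 g₀ K, weightA₁₃ θ hP 0 g₀ os K 0 x)
            - (∑ x ∈ S, weightB₁₃ θ hP 0 g₀ os K 0 x) / (∑ x ∈ classSet₁₃ θ 0 g₀ K, weightB₁₃ θ hP 0 g₀ os K 0 x)| ≤ ρ₀ K)) :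
    ∀ β : ℝ, 2 / 3 < β → β < 1 →
      ∀ (𝔯 : RateReading₁₃CoPH 2) (ksel : RunSel) (ℓ : LetterReading) (ℓ₃ : T4Family → Node00.NE3Letters₁₁) (g B : T4Family → ℝ),
        GuardedReadingN16 𝔯 ksel ℓ ℓ₃ g B → KeyedRatesHolderD4V β (rrOfRecord 𝔯 ksel) →
        ∃ (jc : CutReading) (sh : ShellSplit₁₃CoPH 2 0) (cr : SpineReading), PinnedAtLive jc sh cr ∧
          KeyedRelWeight cr ∧ KeyedShellWeight cr ∧ KeyedExtractionV cr ∧ KeyedCoreEdgeHolderD4V β cr (rrOfRecord 𝔯 ksel) := by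
  refine stubExpansion13HVText_optShell_of_liveLine_of_keyedUndressedClassLawTV_of_keyedBinder hlive fun F θ hP hG hθ g₀ os => ?_
  obtain ⟨hsel, hζm⟩ := hlive F θ hP hG hθ
  obtain ⟨η, ρ₀, hη0, hηs, hρ0s, hTM, hρ0⟩ := hN14 F θ hP hG hθ g₀ os
  refine ⟨η, ρ₀, hη0, hηs, hρ0s, hTM, hρ0, fun K => ?_, fun K => ?_⟩
  · -- E1: the undressed run-A class total IS `Z_{0+K}(0)` of the record's string, positive
    rw [← schemeZ_eq_sum_classSet_weightA 0 θ hP (EOfRecord₁₃ F 2 θ.toStage13Params) hsel (localBgMeasurable F 2 θ.ν) hζm (zeta_nonneg_of_provisos₁₃CoPH F θ hP) g₀ os K 0]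
    exact Summit.QuantumFields.YangMills.Theorems.N20AtRecord13.schemeZ_pos_datumOfRecord₁₃CoPH θ hP g₀ os (0 + K) 0
  · -- E2: the undressed run-B class total IS `Z_{0+K+1}(0)`, positive
    rw [← schemeZ_succ_eq_sum_classSet_weightB 0 θ hP (EOfRecord₁₃ F 2 θ.toStage13Params) hsel (localBgMeasurable F 2 θ.ν) hζm (zeta_nonneg_of_provisos₁₃CoPH F θ hP) g₀ os K 0]
    exact Summit.QuantumFields.YangMills.Theorems.N20AtRecord13.schemeZ_pos_datumOfRecord₁₃CoPH θ hP g₀ os (0 + K + 1) 0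

/-- **★ K3⁸ BY NAME MODULO STUB 1's v6 TEXT — SLIM EDITION**: stub 1's registered v6 text + the keyed live line + (H-ζ) + the TWO letters (keyed undressed class-law TV of record, N14's keyed
binder) ⇒ `SpineGivenEndpointR13SepCoPHV`.  NOT a proof of K3⁸ (stub 1's text and the two letters are DISPLAYED, inhabited for no tuple). [bookkeeping] -/
theorem spineGivenEndpointR13SepCoPHV_of_stubRatesVText_of_liveLine_of_keyedUndressedClassLawTV_of_keyedBinder'
    (h₁ : ∃ β : ℝ, 2 / 3 < β ∧ β < 1 ∧
      ∃ (𝔯 : RateReading₁₃CoPH 2) (ksel : RunSel) (ℓ : LetterReading) (ℓ₃ : T4Family → Node00.NE3Letters₁₁) (g B : T4Family → ℝ),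
        GuardedReadingN16 𝔯 ksel ℓ ℓ₃ g B ∧ KeyedRatesHolderD4V β (rrOfRecord 𝔯 ksel))
    (hlive : ∀ (F : T4Family) (θ : Stage13HParams F 2), θ.Provisos₁₃CoPH F 2 → (θ.ZhUnity F 2 ∧ θ.SlotsNondegenerate₁₃ F 2) → θ.Admissible F 2 →
      LiveSel F θ ∧ ZetaMeasurable F 2 θ.ζ)
    (hN14 : ∀ (F : T4Family) (θ : Stage13HParams F 2) (hP : θ.Provisos₁₃CoPH F 2), (θ.ZhUnity F 2 ∧ θ.SlotsNondegenerate₁₃ F 2) → θ.Admissible F 2 →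
      ∀ (g₀ : ℕ → ℝ) (os : List (ULoop F)), ∃ η ρ₀ : ℕ → ℝ, (∀ K, 0 ≤ η K) ∧ Summable η ∧ Summable ρ₀ ∧
        (letI : DecidableEq (Σ K, SiteSeqKey F (0 + K)) := Classical.decEq _
         TiltedMeanMatching 1 (classSet₁₃ θ 0 g₀) (fun _ _ => ∅)
          (fun K (U : GaugeField (F.P (0 + K)) 0 (Node00.SU 2)) => T4GenFunBounds.prodObs ((datumOfRecord₁₃CoPH F 2 θ hP).scheme g₀) (0 + K) os U) (classMeasA₁₃ θ 0 g₀)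
          (fun K (U : GaugeField (F.P (0 + K + 1)) 0 (Node00.SU 2)) => T4GenFunBounds.prodObs ((datumOfRecord₁₃CoPH F 2 θ hP).scheme g₀) (0 + K + 1) os U) (classMeasB₁₃ θ 0 g₀)
          η) ∧
        (∀ (K : ℕ), ∀ S ⊆ classSet₁₃ θ 0 g₀ K,
          |(∑ x ∈ S, weightA₁₃ θ hP 0 g₀ os K 0 x) / (∑ x ∈ classSet₁₃ θ 0 g₀ K, weightA₁₃ θ hP 0 g₀ os K 0 x)
            - (∑ x ∈ S, weightB₁₃ θ hP 0 g₀ os K 0 x) / (∑ x ∈ classSet₁₃ θ 0 g₀ K, weightB₁₃ θ hP 0 g₀ os K 0 x)| ≤ ρ₀ K)) :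
    Summit.QuantumFields.YangMills.Theses.BalabanUVNodes.SpineGivenEndpointR13SepCoPHV :=
  spineGivenEndpointR13SepCoPHV_of_stubTextsV h₁ (stubExpansion13HVText_optShell_of_liveLine_of_keyedUndressedClassLawTV_of_keyedBinder' hlive hN14)

end YMDAG.N14.StubTwoTextVOfUndressedClassLawTVAndBinder

end
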